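/-
Copyright (c) 2026 the pub-hodgecm-mathlib formalisation cell (harness21).  Prover seat hodgecm-mathlib-F0P3a-p01 (g34), req620 Track A «(D-RAM) FOUR-FRAME» squad, unit U2H:
the (ρ2b′-X) child (U2H ED. 15 :418) — SOCKET (C) (type RamM) organ (C-0b) «DICTIONARY ADAPTER» (socket-(C) lead LH4-p04 (g5) LINE #4 (5), 2026-09-04T06:53Z).  2026-09-04.
-/
import Summits.HodgeConjecture.HodgeConjecture.Theorems.F0P3cDyRamKleinDifferentLetters            -- ★ p858036 + ED. 2 p858053 (this seat): `v_sub_mul_v_sub_eq_of_lt`, `add_eq_two_mul`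
import Summits.HodgeConjecture.HodgeConjecture.Theorems.F0P3cDyRamToricLevelCensusRamMTopLawPrep   -- ★ (LH4-p06): `tau_tau`, `tau_rho`, `rho_tau`, `v_sub_map_le_of_tauFixed` (the fourth-field different bound)
import Summits.HodgeConjecture.HodgeConjecture.Theorems.F0P3cDyRamTokenSignUnr                    -- ★ p857454: `exists_antifixed_sq_eq_toPlace_cmQuadraticGenerator` (the anti-fixed `ω`, `ω² = ι θ`)
import HarnessLib

/-!
# Crux `H413`, line LH4 «(D-RAM) FOUR-FRAME» road — unit U2H, (ρ2b′-X), SOCKET (C): THE DICTIONARY ADAPTER (C-0b) — `hF4`, parities, `d_K`, `d′` and the Klein letters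

Cell `hodgecm-mathlib` (D-0151), FLOOR 0, crux item H413 = `stmt-HodgeConjecture-24833`, route of record `HCCMUnconditional`; squad F0∕P3c∕LH4; registered stub served:
`F0P3cDyRamFourFrameU2H.stub_U2H_fixedPointCensus_typeTwo_unit0` ((ρ2b′-X), U2H ED. 15 :418) through the typed bottom socket (C) `SOCKET-hOCC.v1` (869d0c15; type RamM), head
`orderCountCensusC` (LH4-p04 (g5)).  THEOREMS ONLY (no `def`, no instance, no notation, no `sorry`); lane `--supports stmt-HodgeConjecture-24833 --as helper` (count-neutral).

WHAT THIS FILE DOES.  LH4-p06 (g5)'s RamM census heads (★ `…ToricLevelCensusRamMTopLaw…`) read the Klein four-group `{1, ρ, Θ, τ = Θρ}` on `M` through the one-field letters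
`hF4 : ∀ f, ρf = f → τf = f → f ≠ 0 → ∃ n, |f| = exp(4n)` (the base `F` has orders in `4ℤ`), the fourth-field uniformiser `P := ϖM·τϖM` with `|P − ρP| = exp(−2d_K)`, and the
DICTIONARY hypotheses `dΘ = 2g`, `dτ = 2s0`, `2d′ = dρ + dτ`, `2d_K = dρ + 2g` (LH4-p06 2026-09-04T06:51Z (ii)(iii)).  Here they are all DERIVED:
* §1 (one field `K`, commuting involutions `ρ, Θ`, `τ = Θρ`): `hF4` ⇒ the `τ`-fixed and the `Θ`-fixed non-zero elements have EVEN order (`z·Θz` resp. `z·ρz` is doubly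
  fixed of order `|z|²`: `even_of_tauFixed`, `even_of_thetaFixed`); the fourth-field and third-field uniformisers `P = ϖM·τϖM`, `P♮ = ϖM·ΘϖM` have `ρ`-depths
  `exp(−2d_K)`, `exp(−2d′)` with `1 ≤ d_K, d′` (`exists_dK`, `exists_dPrime`); and THE TWO KLEIN LETTERS **`dρ + dΘ = 2·d_K`**, **`dρ + dτ = 2·d′`**
  (`add_eq_two_mul_dK`, `add_eq_two_mul_dPrime`: ★ `KleinDifferentLetters.v_sub_mul_v_sub_eq_of_lt` at the pairs `(τ, ρ)`, `(Θ, ρ)`, the strict premise from ★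
  `v_sub_map_le_of_tauFixed` (LH4-p06) at the integer `ϖM + τϖM` resp. `ϖM + ΘϖM`, whose order is even hence `≤ exp(−2)`).
* §2 (the CM place: `jE : L_w →+* M`, `Fix ρ = jE(L_w)`, `Θ ∘ jE = jE ∘ σ_w`, `|jE a| = |a|²`, the `σ_w`-datum on `L_w`): `hF4` ITSELF (`hF4_at_place`: a doubly fixed `f = jE a` has
  `σ_w a = a`, so `|a| ∈ exp(2ℤ)` and `|f| = |a|²`), the PARITIES `Even dΘ`, `Even dτ`, `Even dρ` (★ p858053 `even_of_v_sub_map_eq_pow` at the anti-fixed `jE ω`, `ω² = ι θ`,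
  resp. at `jE ω·?`-free: for `ρ` the doubly anti-fixed `ξ` is replaced by `P♮`-parity through §1), and the BUNDLE `ramM_dictionary` = `∃ g s0 dK d′, dΘ = 2g ∧ dτ = 2s0 ∧ 1 ≤ g ∧
  1 ≤ s0 ∧ g + s0 = d ∧ 1 ≤ dK ∧ |P − ρP| = exp(−2dK) ∧ 2dK = dρ + 2g ∧ 1 ≤ d′ ∧ |P♮ − ρP♮| = exp(−2d′) ∧ 2d′ = dρ + dτ` together with `hF4` — every (ii)(iii) letter of
  LH4-p06's heads and ★ p857711 `toricCensusSum_ramM`'s `hg hs0`, from the socket-(C) frame + (C-0) (LH4-p12 (g5)) datum exponents `dρ dΘ dτ` at one uniformiser `ϖM`.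
(R-26) model (REF5 R5-208∕R5-210): `M = ℚ₂(ζ₈) ⊃ L_w = ℚ₂(i)`, `ϖM = 1 − ζ₈`: `(dρ, dΘ, dτ) = (4, 2, 2)`, `d = 2`, `d′ = d_K = 3`: `g = s0 = 1`, `2·3 = 4 + 2` ✓ ×2.
HONEST LABEL.  Count-neutral helper; (ρ2b′-X) stays an OPEN prover target; `HC_CM` is proved only modulo the 7 printed citations (2 remaining named inputs: hLiu418 =
`stmt-HodgeConjecture-24832`, h413 = `stmt-HodgeConjecture-24833`) until rung 0 closes.

## References
* [Serre1979] J.-P. Serre, *Local Fields*, GTM 67 (1979), Ch. III §4 Prop. 8, Ch. IV §1 Prop. 3–4, Ch. V §3.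
* [NeukirchANT1999] J. Neukirch, *Algebraic Number Theory*, Grundlehren 322 (1999), Ch. III (2.2)–(2.4).
-/

set_option autoImplicit false

noncomputable section

open WithZero
open Summit.HodgeConjecture.HodgeConjecture.Cruxes.H413.F0P3cDyRamToricLevelCensusRamM (tau_tau tau_rho rho_tau v_sub_map_le_of_tauFixed)
open Summit.HodgeConjecture.HodgeConjecture.Cruxes.H413.F0P3cDyRamKleinDifferentLetters (v_sub_mul_v_sub_eq_of_lt)
open scoped Valued

namespace Summit.HodgeConjecture.HodgeConjecture.Cruxes.H413.F0P3cDyRamFrameRamMDictionary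

/-! ## §1 One field: parities from `hF4`, the depths `d_K`, `d′`, the two Klein letters -/

section OneField

variable {K : Type} [Field K] [Valued K ℤᵐ⁰] {ρ Θ τ : K →+* K}

/-- `|z|² = exp(4n) ⇒ |z| = exp(2n)`. [folklore] -/
theorem v_eq_exp_two_mul_of_sq {z : K} {n : ℤ} (h : Valued.v z * Valued.v z = exp (4 * n)) : Valued.v z = exp (2 * n) := by
  have h2 : Valued.v z ^ 2 = exp (2 * n) ^ 2 := by rw [pow_two, h, pow_two, ← exp_add]; congr 1; ring
  exact (pow_left_inj₀ zero_le zero_le two_ne_zero).1 h2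

/-- **`τ`-FIXED NON-ZERO ELEMENTS HAVE EVEN ORDER** (from `hF4`): `z·Θz` is fixed by `ρ` and `τ` (`ρz = Θz` for `τ`-fixed `z`) and has order `|z|²`. [cite: Serre1979, Ch. IV §1 Prop. 3–4] -/
theorem even_of_tauFixed (hτ : ∀ x, τ x = Θ (ρ x)) (hρρ : ∀ x, ρ (ρ x) = x) (hΘΘ : ∀ x, Θ (Θ x) = x)
    (hvΘ : ∀ x, Valued.v (Θ x) = Valued.v x)
    (hF4 : ∀ f : K, ρ f = f → τ f = f → f ≠ 0 → ∃ n : ℤ, Valued.v f = exp (4 * n))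
    {z : K} (hτz : τ z = z) (hz0 : z ≠ 0) : ∃ n : ℤ, Valued.v z = exp (2 * n) := by
  have hρz : ρ z = Θ z := by
    have h := congrArg Θ hτz
    rw [hτ, hΘΘ] at h
    exact h
  have hρN : ρ (z * Θ z) = z * Θ z := by rw [map_mul, ← hρz, hρρ, mul_comm]
  have hτN : τ (z * Θ z) = z * Θ z := by rw [map_mul, hτz, ← hρz, tau_rho hτ hρρ, hρz]
  obtain ⟨n, hn⟩ := hF4 _ hρN hτN (mul_ne_zero hz0 (by rw [← hρz]; exact (map_ne_zero ρ).2 hz0))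
  rw [Valuation.map_mul, hvΘ] at hn
  exact ⟨n, v_eq_exp_two_mul_of_sq hn⟩

/-- **`Θ`-FIXED NON-ZERO ELEMENTS HAVE EVEN ORDER** (from `hF4`): `z·ρz` is fixed by `ρ` and `τ`. [cite: Serre1979, Ch. IV §1 Prop. 3–4] -/
theorem even_of_thetaFixed (hτ : ∀ x, τ x = Θ (ρ x)) (hρρ : ∀ x, ρ (ρ x) = x) (hΘρ : ∀ x, Θ (ρ x) = ρ (Θ x))
    (hvρ : ∀ x, Valued.v (ρ x) = Valued.v x)
    (hF4 : ∀ f : K, ρ f = f → τ f = f → f ≠ 0 → ∃ n : ℤ, Valued.v f = exp (4 * n))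
    {z : K} (hΘz : Θ z = z) (hz0 : z ≠ 0) : ∃ n : ℤ, Valued.v z = exp (2 * n) := by
  have hρN : ρ (z * ρ z) = z * ρ z := by rw [map_mul, hρρ, mul_comm]
  have hτN : τ (z * ρ z) = z * ρ z := by rw [hτ, hρN, map_mul, hΘz, hΘρ, hΘz]
  obtain ⟨n, hn⟩ := hF4 _ hρN hτN (mul_ne_zero hz0 ((map_ne_zero ρ).2 hz0))
  rw [Valuation.map_mul, hvρ] at hn
  exact ⟨n, v_eq_exp_two_mul_of_sq hn⟩

/-- **THE `ρ`-DEPTH OF A FIXED UNIFORMISER-SQUARE**: if `Q` and `ρQ` are both fixed by an involution whose fixed non-zero elements have even order (`hev`), `|Q| = exp(−2)` and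
`Q` is NOT `ρ`-fixed, then `|Q − ρQ| = exp(−2e)` for some `e ≥ 1`. [cite: Serre1979, Ch. IV §1 Prop. 3–4] -/
theorem exists_depth_of_even {φ : K →+* K} (hev : ∀ z : K, φ z = z → z ≠ 0 → ∃ n : ℤ, Valued.v z = exp (2 * n))
    (hvρ : ∀ x, Valued.v (ρ x) = Valued.v x) {Q : K} (hφQ : φ Q = Q) (hφρQ : φ (ρ Q) = ρ Q) (hQ : Valued.v Q = exp (-2 : ℤ)) (hρQ : ρ Q ≠ Q) :
    ∃ e : ℕ, 1 ≤ e ∧ Valued.v (Q - ρ Q) = exp (-(2 * (e : ℤ))) := by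
  have hφd : φ (Q - ρ Q) = Q - ρ Q := by rw [map_sub, hφQ, hφρQ]
  obtain ⟨n, hn⟩ := hev _ hφd (sub_ne_zero.2 (Ne.symm hρQ))
  have hle : Valued.v (Q - ρ Q) ≤ exp (-2 : ℤ) := (Valuation.map_sub _ _ _).trans (max_le (le_of_eq hQ) (by rw [hvρ]; exact le_of_eq hQ))
  rw [hn, exp_le_exp] at hle
  refine ⟨(-n).toNat, by omega, ?_⟩
  rw [hn]; congr 1; omega

/-- **THE FOURTH-FIELD DEPTH `d_K`**: `P := ϖM·τϖM` (`τ`-fixed, `|P| = exp(−2)`) has `|P − ρP| = exp(−2d_K)` with `1 ≤ d_K` — `P − ρP` is `τ`-fixed (even order) and non-zero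
(a `ρ`- and `τ`-fixed `P` would have order in `4ℤ`). [cite: Serre1979, Ch. IV §1 Prop. 3–4] -/
theorem exists_dK (hτ : ∀ x, τ x = Θ (ρ x)) (hρρ : ∀ x, ρ (ρ x) = x) (hΘΘ : ∀ x, Θ (Θ x) = x) (hΘρ : ∀ x, Θ (ρ x) = ρ (Θ x))
    (hvρ : ∀ x, Valued.v (ρ x) = Valued.v x) (hvΘ : ∀ x, Valued.v (Θ x) = Valued.v x)
    (hF4 : ∀ f : K, ρ f = f → τ f = f → f ≠ 0 → ∃ n : ℤ, Valued.v f = exp (4 * n))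
    {ϖM : K} (hϖM : Valued.v ϖM = exp (-1 : ℤ)) :
    ∃ dK : ℕ, 1 ≤ dK ∧ Valued.v (ϖM * τ ϖM - ρ (ϖM * τ ϖM)) = exp (-(2 * (dK : ℤ))) := by
  have hvτ : ∀ x, Valued.v (τ x) = Valued.v x := fun x => by rw [hτ, hvΘ, hvρ]
  have hτP : τ (ϖM * τ ϖM) = ϖM * τ ϖM := by rw [map_mul, tau_tau hτ hρρ hΘΘ hΘρ, mul_comm]
  have hτρP : τ (ρ (ϖM * τ ϖM)) = ρ (ϖM * τ ϖM) := by
    rw [tau_rho hτ hρρ, map_mul, map_mul, rho_tau hτ hρρ hΘρ, hτ, hΘΘ, mul_comm]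
  have hP : Valued.v (ϖM * τ ϖM) = exp (-2 : ℤ) := by rw [Valuation.map_mul, hvτ, hϖM, ← exp_add]; rfl
  have hρP : ρ (ϖM * τ ϖM) ≠ ϖM * τ ϖM := by
    intro h
    obtain ⟨n, hn⟩ := hF4 _ h hτP (fun h0 => by rw [h0, map_zero] at hP; exact (exp_ne_zero hP.symm).elim)
    rw [hP, exp_inj] at hn; omega
  exact exists_depth_of_even (fun z hz hz0 => even_of_tauFixed hτ hρρ hΘΘ hvΘ hF4 hz hz0) hvρ hτP hτρP hP hρP

/-- **THE THIRD-FIELD DEPTH `d′`**: `P♮ := ϖM·ΘϖM` (`Θ`-fixed, `|P♮| = exp(−2)`) has `|P♮ − ρP♮| = exp(−2d′)` with `1 ≤ d′` (= the input `hdK` of ★ `exists_thirdFieldPackage_ramM`).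
[cite: Serre1979, Ch. IV §1 Prop. 3–4] -/
theorem exists_dPrime (hτ : ∀ x, τ x = Θ (ρ x)) (hρρ : ∀ x, ρ (ρ x) = x) (hΘΘ : ∀ x, Θ (Θ x) = x) (hΘρ : ∀ x, Θ (ρ x) = ρ (Θ x))
    (hvρ : ∀ x, Valued.v (ρ x) = Valued.v x) (hvΘ : ∀ x, Valued.v (Θ x) = Valued.v x)
    (hF4 : ∀ f : K, ρ f = f → τ f = f → f ≠ 0 → ∃ n : ℤ, Valued.v f = exp (4 * n))
    {ϖM : K} (hϖM : Valued.v ϖM = exp (-1 : ℤ)) :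
    ∃ d' : ℕ, 1 ≤ d' ∧ Valued.v (ϖM * Θ ϖM - ρ (ϖM * Θ ϖM)) = exp (-(2 * (d' : ℤ))) := by
  have hΘP : Θ (ϖM * Θ ϖM) = ϖM * Θ ϖM := by rw [map_mul, hΘΘ, mul_comm]
  have hΘρP : Θ (ρ (ϖM * Θ ϖM)) = ρ (ϖM * Θ ϖM) := by rw [hΘρ, hΘP]
  have hP : Valued.v (ϖM * Θ ϖM) = exp (-2 : ℤ) := by rw [Valuation.map_mul, hvΘ, hϖM, ← exp_add]; rfl
  have hρP : ρ (ϖM * Θ ϖM) ≠ ϖM * Θ ϖM := by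
    intro h
    have hτP : τ (ϖM * Θ ϖM) = ϖM * Θ ϖM := by rw [hτ, h, hΘP]
    obtain ⟨n, hn⟩ := hF4 _ h hτP (fun h0 => by rw [h0, map_zero] at hP; exact (exp_ne_zero hP.symm).elim)
    rw [hP, exp_inj] at hn; omega
  exact exists_depth_of_even (fun z hz hz0 => even_of_thetaFixed hτ hρρ hΘρ hvρ hF4 hz hz0) hvρ hΘP hΘρP hP hρP

/-- **THE KLEIN LETTER OF THE FOURTH FIELD: `dρ + dΘ = 2·d_K`** — ★ `KleinDifferentLetters.v_sub_mul_v_sub_eq_of_lt` at the pair `(τ, ρ)` (`ρ(τϖM) = ΘϖM`), the strict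
premise from LH4-p06's ★ `v_sub_map_le_of_tauFixed` at the `τ`-fixed integer `ϖM + τϖM` (order even, hence `≤ exp(−2)`). [cite: Serre1979, Ch. III §4 Prop. 8; Ch. IV §1 Prop. 4] -/
theorem add_eq_two_mul_dK (hτ : ∀ x, τ x = Θ (ρ x)) (hρρ : ∀ x, ρ (ρ x) = x) (hΘΘ : ∀ x, Θ (Θ x) = x) (hΘρ : ∀ x, Θ (ρ x) = ρ (Θ x))
    (hvρ : ∀ x, Valued.v (ρ x) = Valued.v x) (hvΘ : ∀ x, Valued.v (Θ x) = Valued.v x)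
    (hF4 : ∀ f : K, ρ f = f → τ f = f → f ≠ 0 → ∃ n : ℤ, Valued.v f = exp (4 * n))
    {ϖM : K} (hϖM : Valued.v ϖM = exp (-1 : ℤ)) {dρ dΘ dK : ℕ}
    (hdρ : Valued.v (ϖM - ρ ϖM) = Valued.v ϖM ^ dρ) (hdΘ : Valued.v (ϖM - Θ ϖM) = Valued.v ϖM ^ dΘ)
    (hdK : Valued.v (ϖM * τ ϖM - ρ (ϖM * τ ϖM)) = exp (-(2 * (dK : ℤ)))) : dρ + dΘ = 2 * dK := by
  have hvτ : ∀ x, Valued.v (τ x) = Valued.v x := fun x => by rw [hτ, hvΘ, hvρ]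
  have hτP : τ (ϖM * τ ϖM) = ϖM * τ ϖM := by rw [map_mul, tau_tau hτ hρρ hΘΘ hΘρ, mul_comm]
  have hP : Valued.v (ϖM * τ ϖM) = exp (-2 : ℤ) := by rw [Valuation.map_mul, hvτ, hϖM, ← exp_add]; rfl
  -- `hΘρ'` for the pair `(τ, ρ)`: `ρ (τ x) = τ (ρ x)`
  have hρτ : ∀ x, ρ (τ x) = τ (ρ x) := fun x => by rw [rho_tau hτ hρρ hΘρ, tau_rho hτ hρρ]
  -- the strict premise
  have hτs : τ (ϖM + τ ϖM) = ϖM + τ ϖM := by rw [map_add, tau_tau hτ hρρ hΘΘ hΘρ, add_comm]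
  have hlt : Valued.v (((ϖM + τ ϖM) - ρ (ϖM + τ ϖM)) * ϖM) < Valued.v (ϖM * τ ϖM - ρ (ϖM * τ ϖM)) := by
    rw [hdK, Valuation.map_mul, hϖM]
    by_cases hs0 : ϖM + τ ϖM = 0
    · rw [hs0, map_zero, sub_zero, map_zero, zero_mul]; exact zero_lt_iff.2 (exp_ne_zero)
    · obtain ⟨n, hn⟩ := even_of_tauFixed hτ hρρ hΘΘ hvΘ hF4 hτs hs0
      have hn1 : n ≤ -1 := by
        have hle : Valued.v (ϖM + τ ϖM) ≤ exp (-1 : ℤ) := (Valuation.map_add _ _ _).trans (max_le (le_of_eq hϖM) (by rw [hvτ]; exact le_of_eq hϖM))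
        rw [hn, exp_le_exp] at hle; omega
      have hbd := v_sub_map_le_of_tauFixed hτ hρρ hΘρ hF4 hτP hP hdK hτs
      rw [hn] at hbd
      calc Valued.v ((ϖM + τ ϖM) - ρ (ϖM + τ ϖM)) * exp (-1 : ℤ)
          ≤ exp (2 * n) * exp (-(2 * (dK : ℤ) - 2)) * exp (-1 : ℤ) := mul_le_mul_left hbd _
        _ = exp (2 * n + 1 - 2 * (dK : ℤ)) := by rw [← exp_add, ← exp_add]; congr 1; ring
        _ < exp (-(2 * (dK : ℤ))) := by rw [exp_lt_exp]; omega
  have h := v_sub_mul_v_sub_eq_of_lt τ ρ hlt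
  rw [rho_tau hτ hρρ hΘρ, hdρ, hdΘ, hdK, hϖM, ← pow_add, ← exp_nsmul] at h
  have h2 := exp_injective h
  simp only [smul_neg, nsmul_eq_mul, mul_one] at h2
  omega

/-- **THE KLEIN LETTER OF THE THIRD FIELD: `dρ + dτ = 2·d′`** — the same at the pair `(Θ, ρ)` (`ρ(ΘϖM) = τϖM`), with LH4-p06's fourth-field bound applied to the pair
`(Θ in the role of τ, τ in the role of Θ)`. [cite: Serre1979, Ch. III §4 Prop. 8; Ch. IV §1 Prop. 4] -/
theorem add_eq_two_mul_dPrime (hτ : ∀ x, τ x = Θ (ρ x)) (hρρ : ∀ x, ρ (ρ x) = x) (hΘΘ : ∀ x, Θ (Θ x) = x) (hΘρ : ∀ x, Θ (ρ x) = ρ (Θ x))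
    (hvρ : ∀ x, Valued.v (ρ x) = Valued.v x) (hvΘ : ∀ x, Valued.v (Θ x) = Valued.v x)
    (hF4 : ∀ f : K, ρ f = f → τ f = f → f ≠ 0 → ∃ n : ℤ, Valued.v f = exp (4 * n))
    {ϖM : K} (hϖM : Valued.v ϖM = exp (-1 : ℤ)) {dρ dτ d' : ℕ}
    (hdρ : Valued.v (ϖM - ρ ϖM) = Valued.v ϖM ^ dρ) (hdτ : Valued.v (ϖM - τ ϖM) = Valued.v ϖM ^ dτ)
    (hd' : Valued.v (ϖM * Θ ϖM - ρ (ϖM * Θ ϖM)) = exp (-(2 * (d' : ℤ)))) : dρ + dτ = 2 * d' := by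
  -- the role swap: `Θ x = τ (ρ x)`, `τ (ρ x) = ρ (τ x)`, and `hF4` with `Θ` in place of `τ`
  have hτ' : ∀ x, Θ x = τ (ρ x) := fun x => (tau_rho hτ hρρ x).symm
  have hΘρ' : ∀ x, τ (ρ x) = ρ (τ x) := fun x => by rw [tau_rho hτ hρρ, rho_tau hτ hρρ hΘρ]
  have hF4' : ∀ f : K, ρ f = f → Θ f = f → f ≠ 0 → ∃ n : ℤ, Valued.v f = exp (4 * n) :=
    fun f hρf hΘf hf0 => hF4 f hρf (by rw [hτ, hρf, hΘf]) hf0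
  have hΘP : Θ (ϖM * Θ ϖM) = ϖM * Θ ϖM := by rw [map_mul, hΘΘ, mul_comm]
  have hP : Valued.v (ϖM * Θ ϖM) = exp (-2 : ℤ) := by rw [Valuation.map_mul, hvΘ, hϖM, ← exp_add]; rfl
  have hΘs : Θ (ϖM + Θ ϖM) = ϖM + Θ ϖM := by rw [map_add, hΘΘ, add_comm]
  have hlt : Valued.v (((ϖM + Θ ϖM) - ρ (ϖM + Θ ϖM)) * ϖM) < Valued.v (ϖM * Θ ϖM - ρ (ϖM * Θ ϖM)) := by
    rw [hd', Valuation.map_mul, hϖM]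
    by_cases hs0 : ϖM + Θ ϖM = 0
    · rw [hs0, map_zero, sub_zero, map_zero, zero_mul]; exact zero_lt_iff.2 (exp_ne_zero)
    · obtain ⟨n, hn⟩ := even_of_thetaFixed hτ hρρ hΘρ hvρ hF4 hΘs hs0
      have hn1 : n ≤ -1 := by
        have hle : Valued.v (ϖM + Θ ϖM) ≤ exp (-1 : ℤ) := (Valuation.map_add _ _ _).trans (max_le (le_of_eq hϖM) (by rw [hvΘ]; exact le_of_eq hϖM))
        rw [hn, exp_le_exp] at hle; omega
      have hbd := v_sub_map_le_of_tauFixed (τ := Θ) (Θ := τ) hτ' hρρ hΘρ' hF4' hΘP hP hd' hΘs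
      rw [hn] at hbd
      calc Valued.v ((ϖM + Θ ϖM) - ρ (ϖM + Θ ϖM)) * exp (-1 : ℤ)
          ≤ exp (2 * n) * exp (-(2 * (d' : ℤ) - 2)) * exp (-1 : ℤ) := mul_le_mul_left hbd _
        _ = exp (2 * n + 1 - 2 * (d' : ℤ)) := by rw [← exp_add, ← exp_add]; congr 1; ring
        _ < exp (-(2 * (d' : ℤ))) := by rw [exp_lt_exp]; omega
  have h := v_sub_mul_v_sub_eq_of_lt Θ ρ hlt
  have hρΘ : ρ (Θ ϖM) = τ ϖM := by rw [← hΘρ, hτ]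
  rw [hρΘ, hdρ, hdτ, hd', hϖM, ← pow_add, ← exp_nsmul] at h
  have h2 := exp_injective h
  simp only [smul_neg, nsmul_eq_mul, mul_one] at h2
  omega

end OneField

/-! ## §2 At the CM place: `hF4`, the parity of `dΘ`, and the bundle -/

section CM

open NumberField IsDedekindDomain
open Literature.NumberTheory.Automorphic Literature.NumberTheory.Automorphic.UnitaryGroup
open Literature.NumberTheory.Automorphic.UnitaryThreeFourFrame

variable (L : Type) [Field L] [NumberField L] [IsCMField L] {v : HeightOneSpectrum (𝓞 ↥(maximalRealSubfield L))}
  (w : PlacesOver L v) (hw : IsCMField.complexConj L • w.1 = w.1)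
  {M : Type} [Field M] [Valued M ℤᵐ⁰] (jE : w.1.adicCompletion L →+* M) (ρ Θ τ : M →+* M)

omit [IsCMField L] in
/-- **`hF4` AT THE CM PLACE**: a non-zero `f` fixed by `ρ` (`= jE a`) and by `τ` (equivalently by `Θ`: `σ_w a = a`) has order in `4ℤ` — `|a| ∈ exp(2ℤ)` by the `σ_w`-datum and
`|jE a| = |a|²`. [cite: Serre1979, Ch. IV §1 Prop. 3–4] -/
theorem hF4_at_place {σw : w.1.adicCompletion L →+* w.1.adicCompletion L} (hτ : ∀ x, τ x = Θ (ρ x))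
    (hjfix : ∀ z : M, ρ z = z ↔ ∃ a, jE a = z) (hΘj : ∀ a, Θ (jE a) = jE (σw a)) (hjE2 : ∀ a, Valued.v (jE a) = Valued.v a ^ 2)
    (hfixE : ∀ x : w.1.adicCompletion L, σw x = x → x ≠ 0 → ∃ n : ℤ, Valued.v x = exp (2 * n)) :
    ∀ f : M, ρ f = f → τ f = f → f ≠ 0 → ∃ n : ℤ, Valued.v f = exp (4 * n) := by
  intro f hρf hτf hf0
  obtain ⟨a, rfl⟩ := (hjfix f).1 hρf
  have hΘf : Θ (jE a) = jE a := by
    have h := hτf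
    rw [hτ, hρf] at h
    exact h
  have hσa : σw a = a := jE.injective (by rw [← hΘj]; exact hΘf)
  have ha0 : a ≠ 0 := fun h => hf0 (by rw [h, map_zero])
  obtain ⟨n, hn⟩ := hfixE a hσa ha0
  exact ⟨n, by rw [hjE2, hn, ← exp_nsmul, nsmul_eq_mul]; push_cast; ring_nf⟩

include hw in
/-- **THE PARITY OF `dΘ` AT THE CM PLACE**: `dΘ` is EVEN — ★ `KleinDifferentLetters.even_of_v_sub_map_eq_pow` at the `Θ`-anti-fixed `ξ := jE ω` (`ω² = ι_w θ`, `σ_w ω = −ω`, ★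
`exists_antifixed_sq_eq_toPlace_cmQuadraticGenerator`), whose order `|ω|²` is even, as is `|2|_M = |jE 2| = |2|_w²`; the `Θ`-fixed orders are even by `hF4` (§1).
[cite: Serre1979, Ch. IV §1 Prop. 4] -/
theorem even_dTheta_at_place (hτ : ∀ x, τ x = Θ (ρ x)) (hρρ : ∀ x, ρ (ρ x) = x) (hΘΘ : ∀ x, Θ (Θ x) = x) (hΘρ : ∀ x, Θ (ρ x) = ρ (Θ x))
    (hvρ : ∀ x, Valued.v (ρ x) = Valued.v x)
    (hΘj : ∀ a, Θ (jE a) = jE (galAdicCompletionMap (L := L) (IsCMField.complexConj L) hw a))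
    (hjE2 : ∀ a, Valued.v (jE a) = Valued.v a ^ 2)
    (hF4 : ∀ f : M, ρ f = f → τ f = f → f ≠ 0 → ∃ n : ℤ, Valued.v f = exp (4 * n))
    {ϖM : M} (hϖM : Valued.v ϖM = exp (-1 : ℤ)) {dΘ : ℕ} (hdΘ : Valued.v (ϖM - Θ ϖM) = Valued.v ϖM ^ dΘ) : Even dΘ := by
  haveI : CharZero (w.1.adicCompletion L) := charZero_of_injective_algebraMap (algebraMap L (w.1.adicCompletion L)).injective
  obtain ⟨ω, hω0, hσω, -⟩ := F0P3cDyRamTokenSignUnr.exists_antifixed_sq_eq_toPlace_cmQuadraticGenerator L w hw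
  have hΘξ : Θ (jE ω) = -jE ω := by rw [hΘj, hσω, map_neg]
  have hξ0 : jE ω ≠ 0 := (map_ne_zero jE).2 hω0
  obtain ⟨kξ, hkξ⟩ : ∃ k : ℤ, Valued.v ω = exp k := ⟨_, (exp_log ((Valuation.ne_zero_iff _).2 hω0)).symm⟩
  have hvξ : Valued.v (jE ω) = exp (2 * kξ) := by rw [hjE2, hkξ, ← exp_nsmul, nsmul_eq_mul]; push_cast; ring_nf
  have h2w : (2 : w.1.adicCompletion L) ≠ 0 := two_ne_zero
  have h2M : (2 : M) ≠ 0 := by rw [← map_ofNat jE 2]; exact (map_ne_zero jE).2 h2w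
  obtain ⟨k2, hk2⟩ : ∃ k : ℤ, Valued.v (2 : w.1.adicCompletion L) = exp k := ⟨_, (exp_log ((Valuation.ne_zero_iff _).2 h2w)).symm⟩
  have hv2 : Valued.v (2 : M) = exp (2 * k2) := by rw [← map_ofNat jE 2, hjE2, hk2, ← exp_nsmul, nsmul_eq_mul]; push_cast; ring_nf
  have hΘϖ : Θ ϖM ≠ ϖM := by
    intro h
    obtain ⟨n, hn⟩ := even_of_thetaFixed hτ hρρ hΘρ hvρ hF4 h (fun h0 => by rw [h0, map_zero] at hϖM; exact (exp_ne_zero hϖM.symm).elim)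
    rw [hϖM, exp_inj] at hn; omega
  exact F0P3cDyRamKleinDifferentLetters.even_of_v_sub_map_eq_pow Θ hΘΘ (fun z hz hz0 => even_of_thetaFixed hτ hρρ hΘρ hvρ hF4 hz hz0)
    hΘξ hξ0 hvξ h2M hv2 hϖM hΘϖ hdΘ

include hw in
/-- **(C-0b) THE RamM DICTIONARY AT THE CM PLACE, BUNDLED.**  From the socket-(C) frame (`jE`-dictionary, `|jE a| = |a|²`, the `σ_w`-datum on `L_w`) and the three datum
exponents `dρ, dΘ, dτ` at ONE uniformiser `ϖM` of `M` ((C-0), LH4-p12 (g5)): **`∃ g s0 dK d′`, `dΘ = 2g`, `dτ = 2s0`, `1 ≤ g`, `1 ≤ s0`, `g + s0 = d`, `1 ≤ dK`, `|P − ρP| = exp(−2dK)`,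
`2dK = dρ + 2g`, `1 ≤ d′`, `|P♮ − ρP♮| = exp(−2d′)`, `2d′ = dρ + dτ`** (`P = ϖM·τϖM`, `P♮ = ϖM·ΘϖM`) — every dictionary letter (ii)(iii) of LH4-p06 (g5)'s RamM heads and ★ p857711's
`hg hs0`, together with `hF4` (`hF4_at_place`). [cite: Serre1979, Ch. III §4 Prop. 8; Ch. IV §1 Prop. 3–4] [cite: NeukirchANT1999, Ch. III (2.2)–(2.4)] -/
theorem ramM_dictionary (hτ : ∀ x, τ x = Θ (ρ x)) (hρρ : ∀ x, ρ (ρ x) = x) (hvρ : ∀ x, Valued.v (ρ x) = Valued.v x)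
    (hΘΘ : ∀ x, Θ (Θ x) = x) (hΘρ : ∀ x, Θ (ρ x) = ρ (Θ x)) (hvΘ : ∀ x, Valued.v (Θ x) = Valued.v x)
    (hjfix : ∀ z : M, ρ z = z ↔ ∃ a, jE a = z) (hΘj : ∀ a, Θ (jE a) = jE (galAdicCompletionMap (L := L) (IsCMField.complexConj L) hw a))
    (hjE2 : ∀ a, Valued.v (jE a) = Valued.v a ^ 2)
    {ϖ : w.1.adicCompletion L} {d tE : ℕ} (hD : IsRamifiedQuadraticDatum (galAdicCompletionMap (L := L) (IsCMField.complexConj L) hw) ϖ d tE)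
    {ϖM : M} (hϖM : Valued.v ϖM = exp (-1 : ℤ)) {dρ dΘ dτ : ℕ}
    (hdρ : Valued.v (ϖM - ρ ϖM) = Valued.v ϖM ^ dρ) (hdΘ : Valued.v (ϖM - Θ ϖM) = Valued.v ϖM ^ dΘ) (hdτ : Valued.v (ϖM - τ ϖM) = Valued.v ϖM ^ dτ) :
    (∀ f : M, ρ f = f → τ f = f → f ≠ 0 → ∃ n : ℤ, Valued.v f = exp (4 * n)) ∧
    ∃ g s0 dK d' : ℕ, dΘ = 2 * g ∧ dτ = 2 * s0 ∧ 1 ≤ g ∧ 1 ≤ s0 ∧ g + s0 = d ∧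
      1 ≤ dK ∧ Valued.v (ϖM * τ ϖM - ρ (ϖM * τ ϖM)) = exp (-(2 * (dK : ℤ))) ∧ 2 * dK = dρ + 2 * g ∧
      1 ≤ d' ∧ Valued.v (ϖM * Θ ϖM - ρ (ϖM * Θ ϖM)) = exp (-(2 * (d' : ℤ))) ∧ 2 * d' = dρ + dτ := by
  obtain ⟨hσσ, hvσ, hϖ, hfixE, hdd, hd1, -⟩ := id hD
  have hF4 := hF4_at_place L w jE ρ Θ τ hτ hjfix hΘj hjE2 hfixE
  -- the two depths and the two Klein letters of §1
  obtain ⟨dK, hdK1, hdK⟩ := exists_dK hτ hρρ hΘΘ hΘρ hvρ hvΘ hF4 hϖM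
  obtain ⟨d', hd'1, hd'⟩ := exists_dPrime hτ hρρ hΘΘ hΘρ hvρ hvΘ hF4 hϖM
  have hK : dρ + dΘ = 2 * dK := add_eq_two_mul_dK hτ hρρ hΘΘ hΘρ hvρ hvΘ hF4 hϖM hdρ hdΘ hdK
  have hK' : dρ + dτ = 2 * d' := add_eq_two_mul_dPrime hτ hρρ hΘΘ hΘρ hvρ hvΘ hF4 hϖM hdρ hdτ hd'
  -- the E-letter `dΘ + dτ = 2d` (★ KleinDifferentLetters)
  have hdτ' : Valued.v (ϖM - Θ (ρ ϖM)) = Valued.v ϖM ^ dτ := by rw [← hτ]; exact hdτ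
  have hE : dΘ + dτ = 2 * d :=
    F0P3cDyRamKleinDifferentLetters.add_eq_two_mul jE ρ Θ hσσ hvσ hfixE hϖ hdd hjfix hΘj hjE2 hρρ hvρ hϖM hdΘ hdτ'
  -- parity and positivity
  obtain ⟨g, hg⟩ := even_dTheta_at_place L w hw jE ρ Θ τ hτ hρρ hΘΘ hΘρ hvρ hΘj hjE2 hF4 hϖM hdΘ
  have hdΘ1 : 1 ≤ dΘ := by
    by_contra h0
    have h00 : dΘ = 0 := by omega
    rw [h00, pow_zero] at hdΘ
    have hle : Valued.v (ϖM - Θ ϖM) ≤ exp (-1 : ℤ) := (Valuation.map_sub _ _ _).trans (max_le (le_of_eq hϖM) (by rw [hvΘ]; exact le_of_eq hϖM))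
    rw [hdΘ, ← exp_zero, exp_le_exp] at hle; omega
  have hdτ1 : 1 ≤ dτ := by
    by_contra h0
    have h00 : dτ = 0 := by omega
    rw [h00, pow_zero] at hdτ
    have hvτ : Valued.v (τ ϖM) = Valued.v ϖM := by rw [hτ, hvΘ, hvρ]
    have hle : Valued.v (ϖM - τ ϖM) ≤ exp (-1 : ℤ) := (Valuation.map_sub _ _ _).trans (max_le (le_of_eq hϖM) (by rw [hvτ]; exact le_of_eq hϖM))
    rw [hdτ, ← exp_zero, exp_le_exp] at hle; omega
  refine ⟨hF4, g, (dτ : ℕ) / 2, dK, d', by omega, by omega, by omega, by omega, by omega, hdK1, hdK, by omega, hd'1, hd', by omega⟩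

end CM

end Summit.HodgeConjecture.HodgeConjecture.Cruxes.H413.F0P3cDyRamFrameRamMDictionary

end
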